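import Literature.AlgebraicGeometry.HodgeTheory.AlgebraicityLocusBoundary
import Literature.AlgebraicGeometry.HodgeTheory.AlgebraicityLocusWitnesses
import Literature.AlgebraicGeometry.HodgeTheory.AbelianVarietyPullbackAlgebraicClasses
import Literature.AlgebraicGeometry.Motives.CurveThroughTwoPointsProofs
import HarnessLib

/-!
# Restriction of algebraic classes to the fibres of a smooth projective family (proved)

Topic `Literature/AlgebraicGeometry/HodgeTheory` (family `hodge`). Theorems only (sorry-free; no
definition, no named fact). On the tree's carrier `algebraicClasses X p = Nᵖ H²ᵖ(X(ℂ); ℂ)` (classes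
killed off a Zariski-closed subset all of whose points have codimension `≥ p`, `AlgebraicClasses`),
this file PROVES the contravariance of algebraic classes along the inclusion `ι_s : 𝒳_s ⟶ 𝒳` of
ANY fibre of a smooth projective family `f : 𝒳 ⟶ S` over a smooth irreducible quasi-projective
complex base, and along `ι_s ≫ i` for a flat `i : 𝒳 ⟶ Y` (e.g. the open immersion of `𝒳` into a
smooth projective compactification `Y = 𝒳̄`):

* `map_fiberι_mem_algebraicClasses` — **`ι_s^*(Nᵖ H²ᵖ(𝒳(ℂ); ℂ)) ⊆ Nᵖ H²ᵖ(𝒳_s(ℂ); ℂ)` for every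
  complex point `s` of `S`**;
* `map_fiberι_comp_mem_algebraicClasses_of_flat`,
  `map_fiberι_comp_mem_algebraicClasses_of_isSmoothProjective` — the same for `(ι_s ≫ i)^*`,
  `i : 𝒳 ⟶ Y` flat with `Y` locally Noetherian, resp. an open immersion into a smooth projective `Y`.

In print this is the case `X = 𝒳_s → Y = 𝒳̄` of "the mapping `cl : A^*X → H^*X` is … contravariant
for morphisms of non-singular varieties" (Fulton, *Intersection Theory*, Cor. 19.2 (b); Voisin,
*Hodge Theory II*, Prop. 9.21 (i)), i.e. of the tree's named fact
`fulton1998_map_mem_algebraicClasses` (`AlgebraicClassesPullback.lean`), whose general case needs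
Chow's moving lemma or refined Gysin maps, absent from the tree. For the inclusion of a FIBRE no
cycle has to be moved: the specialisation of algebraic cycles along a curve does the work (Fulton
§10.1, Cor. 10.1 and Example 10.1.2, "`i_t^*[W] = [W_t]`"; §20.3), in the form in which the tree
already has it — the boundary step of Charles–Schnell's proof of Prop. 11.3.11
(`AlgebraicityLocusBoundary.mem_algebraicClasses_of_mem_irreducible`: on an irreducible parameter
variety, algebraicity of the restrictions of a class on the total space spreads from a non-empty
open part, where the supports have the right codimension in the fibres, to ALL complex points;
limits of supported classes along the smooth curve through two points of Mumford's lemma, which is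
PROVED in the tree, `Motives.mumford_smoothCurve_through_two_points_holds`).

## Proof of `map_fiberι_mem_algebraicClasses`

Let `A` die off a closed `Z ⊆ 𝒳` all of whose points have codimension `≥ p` (the generators of
`Nᵖ`; sums by linearity, `Submodule.iSup_induction'`). `𝒳` is smooth over `ℂ` of relative dimension
`n + d`, `d = dim S`, so every `z ∈ Z` has `dim closure {z} ≤ n + d - p`
(`Motives.krullDim_eq_of_smoothOfRelativeDimension`). By the generic fibre dimension over complex
points (`exists_isOpen_forall_height_add_le_of_isClosed`, Springer 5.1.6 (ii) / Hartshorne II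
Ex. 3.22, PROVED in `AbelianVarietyPullbackAlgebraicClasses`) there is a non-empty Zariski-open
`U ⊆ S` over whose complex points the points of `Z` have `dim closure + d ≤ n + d - p`, i.e.
`Z ∩ 𝒳_t` has codimension `≥ p` in `𝒳_t`. Apply `mem_algebraicClasses_of_mem_irreducible` to the
parameter scheme `H = S` (`h = 𝟙`), the closed family of supports `𝒵 = Γ_f(Z) ⊆ 𝒳 × S` (image of
`Z` under the graph `(𝟙, f)`, a closed immersion since `S` is separated,
`SupportFamily.isClosedImmersion_lift_id`), whose slice at `y` through `𝒳_y` is `ι_y⁻¹ Z`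
(`preimage_lift_fiberι_image_lift_id`), the irreducible closed `Y = S` and the open `U`: `ι_y^* A`
dies off `ι_y⁻¹ Z` at every `y` (`complexBetti.restrictCompl_map_eq_zero`), which has codimension
`≥ p` for `y` over `U`; hence `ι_s^* A ∈ Nᵖ H²ᵖ(𝒳_s(ℂ); ℂ)` at EVERY complex point `s`.

Consumer: the last step ("it is then true for `β` and thus also for `α`", restriction of the
algebraic class `β` of the compactified family to the fibre `X''_{s''}`) of Voisin's proof of
Prop. 0.7 of *Hodge loci and absolute Hodge classes* (`HodgeGenericQbarDescentTwoFacts.lean`), where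
it replaces the named fact `fulton1998_map_mem_algebraicClasses`.

## References

* [Fulton1998] W. Fulton, *Intersection Theory*, 2nd ed. (1998), §10.1 (Cor. 10.1,
  Example 10.1.2), §19.2 Cor. 19.2 (b), §20.3.
* [VoisinHodgeII2003] C. Voisin, *Hodge Theory and Complex Algebraic Geometry II* (2003),
  Prop. 9.21 (i); §3.3.1, §7.3.2.
* [CharlesSchnell2014Notes] F. Charles, C. Schnell, *Notes on absolute Hodge classes* (2014),
  Prop. 11.3.11 (proof).
* [GrothendieckTopology1969] A. Grothendieck, *Hodge's general conjecture is false for trivial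
  reasons*, Topology 8 (1969), §1.
* [Hartshorne1977] R. Hartshorne, *Algebraic Geometry* (1977), II Ex. 3.22.
-/

noncomputable section

open CategoryTheory AlgebraicGeometry Limits Set Order MonoidalCategory CartesianMonoidalCategory
open _root_.Topology TopologicalSpace
open Literature.AlgebraicGeometry.Motives

namespace Literature.AlgebraicGeometry.HodgeTheory

section HodgeTheory

variable {𝒳 S : Motives.SchemeOver ℂ} (f : 𝒳 ⟶ S)

/-! ### Points of the graph family of supports `Γ_f(Z) ⊆ 𝒳 × S` -/

/-- `pr_𝒳 (Γ_f x) = x` for the graph `Γ_f = (𝟙, f) : 𝒳 ⟶ 𝒳 × S`. [folklore] -/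
theorem fst_lift_id_base (x : 𝒳.left) :
    (fst 𝒳 S).left.base ((lift (𝟙 𝒳) f).left.base x) = x := by
  change ((lift (𝟙 𝒳) f) ≫ fst 𝒳 S).left.base x = x
  rw [lift_fst]
  rfl

/-- `pr_S (Γ_f x) = f x` for the graph `Γ_f = (𝟙, f) : 𝒳 ⟶ 𝒳 × S`. [folklore] -/
theorem snd_lift_id_base (x : 𝒳.left) :
    (snd 𝒳 S).left.base ((lift (𝟙 𝒳) f).left.base x) = f.left.base x := by
  change ((lift (𝟙 𝒳) f) ≫ snd 𝒳 S).left.base x = _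
  rw [lift_snd]

/-- `pr_𝒳 (i_y x) = x` for the slice `i_y : 𝒳 ⟶ 𝒳 × S` at a complex point `y` of `S`.
[folklore] -/
theorem fst_sliceAt_base (y : Motives.ComplexPoints S) (x : 𝒳.left) :
    (fst 𝒳 S).left.base ((sliceAt 𝒳 y).left.base x) = x := by
  change (sliceAt 𝒳 y ≫ fst 𝒳 S).left.base x = x
  rw [sliceAt_fst]
  rfl

/-- **Points of `𝒳 × S` over a complex point of `S` are determined by their first projection**
(they are slices, `exists_sliceAt_base_eq`). [folklore] -/
theorem eq_of_snd_eq_pt_of_fst_eq (y : Motives.ComplexPoints S) {w w' : (𝒳 ⊗ S).left}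
    (hw : (snd 𝒳 S).left.base w = y.pt) (hw' : (snd 𝒳 S).left.base w' = y.pt)
    (h : (fst 𝒳 S).left.base w = (fst 𝒳 S).left.base w') : w = w' := by
  obtain ⟨x, rfl⟩ := exists_sliceAt_base_eq y w hw
  obtain ⟨x', rfl⟩ := exists_sliceAt_base_eq y w' hw'
  rw [fst_sliceAt_base, fst_sliceAt_base] at h
  rw [h]

/-- **The slice of the graph family `Γ_f(Z)` through a fibre is the trace of `Z` on the fibre**:
for `Z ⊆ 𝒳`, a complex point `y` of `S` and a complex point `t` with `pt t = pt y`, the preimage of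
`Γ_f(Z) ⊆ 𝒳 × S` under `(ι_t, y) : 𝒳_t ⟶ 𝒳 × S` is `ι_t⁻¹ Z`. [folklore] -/
theorem preimage_lift_fiberι_image_lift_id (Z : Set 𝒳.left) (y t : Motives.ComplexPoints S)
    (ht : t.pt = y.pt) :
    (lift (Motives.fiberι f t) (Motives.fiberOverToSpec f t ≫ y)).left.base ⁻¹'
        ((lift (𝟙 𝒳) f).left.base '' Z) =
      (Motives.fiberι f t).left.base ⁻¹' Z := by
  ext z
  rw [Set.mem_preimage, Set.mem_preimage, lift_fiberι_base_apply]
  constructor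
  · rintro ⟨x', hx'Z, hx'⟩
    have h1 := congrArg (fun w => (fst 𝒳 S).left.base w) hx'
    simp only [fst_lift_id_base, fst_sliceAt_base] at h1
    rw [← h1]
    exact hx'Z
  · intro hz
    -- `f (ι_t z) = pt t` (the tree's `apply_fiberι_base_eq_pt`, `SpreadSupportsSpreadSet`, whose
    -- imports are unrelated; four lines repeated)
    have hft : f.left.base ((Motives.fiberι f t).left.base z) = t.pt := by
      have h := congrArg (fun φ => φ.left.base z) (Motives.fiberι_comp f t)
      simp only [Over.comp_left, Scheme.Hom.comp_base, TopCat.coe_comp, Function.comp_apply] at h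
      rw [h]
      change t.left.base _ = t.left.base (IsLocalRing.closedPoint ℂ)
      exact congrArg t.left.base (Subsingleton.elim (α := PrimeSpectrum ℂ) _ _)
    refine ⟨(Motives.fiberι f t).left.base z, hz, ?_⟩
    apply eq_of_snd_eq_pt_of_fst_eq y
    · rw [snd_lift_id_base, hft, ht]
    · exact snd_sliceAt_base y _
    · rw [fst_lift_id_base, fst_sliceAt_base]

/-! ### Restriction of algebraic classes to the fibres -/

/-- **Restriction of algebraic classes to the fibres of a smooth projective family** (the case of a
fibre inclusion of "`cl` is contravariant for morphisms of non-singular varieties", Fulton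
Cor. 19.2 (b), via specialisation of cycles, Fulton Cor. 10.1 and Example 10.1.2, on the support
carrier `Nᵖ H²ᵖ`). Let `f : 𝒳 ⟶ S` be a smooth projective family of relative dimension `n` over a
smooth irreducible quasi-projective complex base and `A ∈ Nᵖ H²ᵖ(𝒳(ℂ); ℂ)` (a class on the TOTAL
space killed off a Zariski-closed subset of codimension `≥ p`). Then `ι_s^* A ∈ Nᵖ H²ᵖ(𝒳_s(ℂ); ℂ)`
at EVERY complex point `s` of `S`. Proof (module docstring): generic fibre dimension of the support
over `S` (`exists_isOpen_forall_height_add_le_of_isClosed`) and the boundary step of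
Charles–Schnell's Prop. 11.3.11 for the graph family of supports `Γ_f(Z) ⊆ 𝒳 × S`
(`mem_algebraicClasses_of_mem_irreducible`, with Mumford's curve lemma
`Motives.mumford_smoothCurve_through_two_points_holds`).
[cite: Fulton1998, §10.1 Cor. 10.1, Example 10.1.2 and §19.2 Cor. 19.2 (b)]
[cite: CharlesSchnell2014Notes, Prop. 11.3.11 (proof)] [cite: GrothendieckTopology1969, §1] -/
theorem map_fiberι_mem_algebraicClasses {n : ℕ} (hfam : Motives.IsSmoothProjectiveFamily f n)
    (hS : IsQuasiProjectiveOver S) [IrreducibleSpace S.left] [Smooth S.hom] {p : ℕ}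
    {A : complexBetti 𝒳 (2 * p)} (hA : A ∈ algebraicClasses 𝒳 p) (s : Motives.ComplexPoints S) :
    complexBetti.map (Motives.fiberι f s) (2 * p) A ∈
      algebraicClasses (Motives.fiberOver f s) p := by
  -- instances on `S` and `𝒳`
  haveI : LocallyOfFiniteType S.hom := hS.locallyOfFiniteType
  haveI : IsSeparated S.hom := hS.isVarietyPair_ofScheme.isSeparated
  haveI : IsReduced S.left := isReduced_of_smooth_over_field S.hom
  haveI : IsIntegral S.left := isIntegral_of_irreducibleSpace_of_isReduced _
  obtain ⟨d, hd⟩ := exists_smoothOfRelativeDimension_of_smooth S.hom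
  haveI := hd
  obtain ⟨h𝒳ft, h𝒳qc⟩ := locallyOfFiniteType_and_quasiCompact_hom f hfam hS
  haveI := h𝒳ft
  haveI := h𝒳qc
  haveI : IsLocallyNoetherian 𝒳.left := LocallyOfFiniteType.isLocallyNoetherian 𝒳.hom
  haveI : CompactSpace 𝒳.left := QuasiCompact.compactSpace_of_compactSpace 𝒳.hom
  haveI : IsNoetherian 𝒳.left := {}
  haveI := hfam.smoothOfRelativeDimension
  haveI : SmoothOfRelativeDimension (n + d) 𝒳.hom := by
    have h : SmoothOfRelativeDimension (n + d) (f.left ≫ S.hom) := inferInstance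
    rwa [Over.w f] at h
  -- the generic point of `S` has dimension `d`
  have hdim : height (genericPoint S.left) = (d : ℕ∞) := by
    have h := height_add_coheight_eq_of_smoothOfRelativeDimension S.hom d (genericPoint S.left)
    have h0 : coheight (genericPoint S.left) = 0 := by
      rw [Order.coheight_eq_zero]
      intro b _
      exact Scheme.le_iff_specializes.2 (genericPoint_specializes b)
    rwa [h0, add_zero] at h
  -- `dim closure {z} + codim z ≤ dim 𝒳 = n + d` on `𝒳`
  have hhc : ∀ z : 𝒳.left, height z + coheight z ≤ ((n + d : ℕ) : ℕ∞) := by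
    intro z
    haveI : Nonempty 𝒳.left := ⟨z⟩
    have h := Order.krullDim_eq_iSup_height_add_coheight_of_nonempty (α := 𝒳.left)
    rw [krullDim_eq_of_smoothOfRelativeDimension 𝒳.hom (n + d)] at h
    have h' : (⨆ a : 𝒳.left, height a + coheight a) = ((n + d : ℕ) : ℕ∞) := by
      exact_mod_cast h.symm
    rw [← h']
    exact le_iSup (fun a : 𝒳.left => height a + coheight a) z
  -- reduce to a class dying off ONE closed `Z` of codimension `≥ p`
  induction hA using Submodule.iSup_induction' with
  | mem Z x hxZ =>
    by_cases hZ : IsClosed Z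
    · rw [iSup_pos hZ] at hxZ
      by_cases hZp : ∀ z ∈ Z, (p : ℕ∞) ≤ Order.coheight z
      · rw [iSup_pos hZp, LinearMap.mem_ker] at hxZ
        -- heights of the points of `Z`
        have hZh' : ∀ z ∈ Z, height z + (p : ℕ∞) ≤ ((n + d : ℕ) : ℕ∞) := fun z hz =>
          (add_le_add le_rfl (hZp z hz)).trans (hhc z)
        have hZfin : ∀ z ∈ Z, ∃ a : ℕ, height z = a ∧ a + p ≤ n + d := by
          intro z hz
          have h := hZh' z hz
          have hfin : height z ≠ ⊤ := by
            intro htop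
            rw [htop, top_add] at h
            exact absurd h (by simp)
          obtain ⟨a, ha⟩ := ENat.ne_top_iff_exists.1 hfin
          refine ⟨a, ha.symm, ?_⟩
          rw [← ha] at h
          exact_mod_cast h
        have hZh : ∀ z ∈ Z, height z ≤ ((n + d - p : ℕ) : ℕ∞) := by
          intro z hz
          obtain ⟨a, ha, hap⟩ := hZfin z hz
          rw [ha]
          exact_mod_cast (show a ≤ n + d - p by omega)
        -- the good open `U ⊆ S`: over it, `Z` meets the fibres in codimension `≥ p`
        obtain ⟨U, hUo, hUne, hU⟩ := exists_isOpen_forall_height_add_le_of_isClosed f hdim hZ hZh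
        -- the graph family of supports `𝒵 = Γ_f(Z) ⊆ 𝒳 × S`, closed
        haveI := SupportFamily.isClosedImmersion_lift_id f
        have h𝒵 : IsClosed ((lift (𝟙 𝒳) f).left.base '' Z) :=
          (lift (𝟙 𝒳) f).left.isClosedEmbedding.isClosedMap _ hZ
        -- the boundary theorem on the irreducible parameter variety `S`
        have key := mem_algebraicClasses_of_mem_irreducible f
          mumford_smoothCurve_through_two_points_holds hfam hS ‹Smooth S.hom› (𝟙 S) h𝒵 p x
          isClosed_univ (IrreducibleSpace.isIrreducible_univ S.left) hUo
          (by simpa using hUne) ?_ ?_ s (Set.mem_univ _)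
        · rw [AlgPoints.map_id_apply] at key
          exact key
        · -- codimension `≥ p` of the slices over `U`
          rintro y ⟨hyU, -⟩ x' ⟨z, hzZ, hz⟩
          have h1 : z = x' := by
            have h := congrArg (fun w => (fst 𝒳 S).left.base w) hz
            simpa only [fst_lift_id_base, fst_sliceAt_base] using h
          subst h1
          have h2 : f.left.base z = y.pt := by
            have h := congrArg (fun w => (snd 𝒳 S).left.base w) hz
            simpa only [snd_lift_id_base, snd_sliceAt_base] using h
          have h3 := hU y hyU z hzZ h2
          obtain ⟨a, ha, hap⟩ := hZfin z hzZ
          rw [ha] at h3 ⊢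
          have h3' : a + d ≤ n + d - p := by exact_mod_cast h3
          exact_mod_cast (show a + p ≤ n by omega)
        · -- `ι_y^* A` dies off the slice `ι_y⁻¹ Z` at every `y`
          intro y _
          rw [LinearMap.mem_ker,
            preimage_lift_fiberι_image_lift_id f Z y (AlgPoints.map (𝟙 S) y)
              (by rw [AlgPoints.map_id_apply])]
          exact complexBetti.restrictCompl_map_eq_zero (Motives.fiberι f _) hxZ
      · rw [iSup_neg hZp] at hxZ
        rw [(Submodule.mem_bot ℂ).1 hxZ, map_zero]
        exact Submodule.zero_mem _
    · rw [iSup_neg hZ] at hxZ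
      rw [(Submodule.mem_bot ℂ).1 hxZ, map_zero]
      exact Submodule.zero_mem _
  | zero =>
    rw [map_zero]
    exact Submodule.zero_mem _
  | add x y _ _ ihx ihy =>
    rw [map_add]
    exact Submodule.add_mem _ ihx ihy

/-- **Restriction of algebraic classes along `𝒳_s ⟶ 𝒳 ⟶ Y`, `i : 𝒳 ⟶ Y` flat**: for `f : 𝒳 ⟶ S`
a smooth projective family over a smooth irreducible quasi-projective base, `i : 𝒳 ⟶ Y` a flat
`ℂ`-morphism to a locally Noetherian `Y` and `β ∈ Nᵖ H²ᵖ(Y(ℂ); ℂ)`: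
`(ι_s ≫ i)^* β ∈ Nᵖ H²ᵖ(𝒳_s(ℂ); ℂ)` at every complex point `s` (flat pull-back respects the support
filtration, `map_mem_algebraicClasses_of_flat`, then `map_fiberι_mem_algebraicClasses`).
[cite: Fulton1998, §19.2 Cor. 19.2 (b) and §10.1 Cor. 10.1] [cite: GrothendieckTopology1969, §1] -/
theorem map_fiberι_comp_mem_algebraicClasses_of_flat {n : ℕ}
    (hfam : Motives.IsSmoothProjectiveFamily f n) (hS : IsQuasiProjectiveOver S)
    [IrreducibleSpace S.left] [Smooth S.hom] {Y : Motives.SchemeOver ℂ} (i : 𝒳 ⟶ Y) [Flat i.left]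
    [IsLocallyNoetherian Y.left] {p : ℕ} {β : complexBetti Y (2 * p)}
    (hβ : β ∈ algebraicClasses Y p) (s : Motives.ComplexPoints S) :
    complexBetti.map (Motives.fiberι f s ≫ i) (2 * p) β ∈
      algebraicClasses (Motives.fiberOver f s) p := by
  obtain ⟨h𝒳ft, -⟩ := locallyOfFiniteType_and_quasiCompact_hom f hfam hS
  haveI := h𝒳ft
  haveI : IsLocallyNoetherian 𝒳.left := LocallyOfFiniteType.isLocallyNoetherian 𝒳.hom
  rw [complexBetti.map_comp, ModuleCat.comp_apply]
  exact map_fiberι_mem_algebraicClasses f hfam hS (map_mem_algebraicClasses_of_flat i hβ) s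

/-- **Restriction of algebraic classes from a smooth projective ambient variety to the fibres of a
smooth projective family it contains as an open subfamily** — the shape consumed by Voisin's proof
of Prop. 0.7 of *Hodge loci and absolute Hodge classes* ("it is then true for `β` and thus also
for `α`": `β` algebraic on the compactification `𝒳̄` of the family, `α = β|_{X_0}`): for
`i : 𝒳 ⟶ Y` an open immersion into a smooth projective `Y` and `β ∈ algebraicClasses Y p`,
`(ι_s ≫ i)^* β ∈ algebraicClasses (𝒳_s) p` at every complex point `s`. This is the instance
`j = ι_s ≫ i : 𝒳_s ⟶ Y` of the named fact `fulton1998_map_mem_algebraicClasses`, PROVED.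
[cite: Fulton1998, §19.2 Cor. 19.2 (b) and §10.1 Cor. 10.1]
[cite: Voisin2007HodgeLoci, §3, proof of Prop. 1.7 (arXiv math/0605766 p. 7)] -/
theorem map_fiberι_comp_mem_algebraicClasses_of_isSmoothProjective {n m : ℕ}
    (hfam : Motives.IsSmoothProjectiveFamily f n) (hS : IsQuasiProjectiveOver S)
    [IrreducibleSpace S.left] [Smooth S.hom] {Y : Motives.SchemeOver ℂ}
    (hY : Motives.IsSmoothProjective m Y) (i : 𝒳 ⟶ Y) [IsOpenImmersion i.left] {p : ℕ}
    {β : complexBetti Y (2 * p)} (hβ : β ∈ algebraicClasses Y p) (s : Motives.ComplexPoints S) :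
    complexBetti.map (Motives.fiberι f s ≫ i) (2 * p) β ∈
      algebraicClasses (Motives.fiberOver f s) p := by
  haveI : IsLocallyNoetherian Y.left := Motives.IsSmoothProjective.isLocallyNoetherian_holds hY
  exact map_fiberι_comp_mem_algebraicClasses_of_flat f hfam hS i hβ s

end HodgeTheory

end Literature.AlgebraicGeometry.HodgeTheory

end
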